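import Summits.BirchSwinnertonDyer.BirchSwinnertonDyer.Theorems.ByReductionTypeAtTwoMultUpperHalfTowerSplitOneBit
import Summits.BirchSwinnertonDyer.BirchSwinnertonDyer.Theorems.ByReductionTypeAtTwoMultTowerSplitOneBitHolds
import HarnessLib

/-!
# Route `ByReductionTypeAtTwo`, crux `MultUpperHalfAtTwo` (item stmt-BirchSwinnertonDyer-19922): the ONE-BIT TOWER-gap doors at a
# SPLIT multiplicative `2` with the binder `hSP1` DISCHARGED by the kernel theorem
# `MultTowerSP1.sec3_natCard_pTorsion_localTowerKerPrimary_le_splitMultiplicative_rat_holds`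

HONEST FRAMING (cell `bsd-2adic`, run/shared/lean/pub/bsd-2adic/, seat `bsd-2adic-tower-1` GEN 10, HUMAN RULINGS D-0036 / D-0054 /
D-0074): research route; THEOREMS ONLY; nothing is booked; BSD is not proved by any of this. These are the three split one-bit doors of
`…MultUpperHalfTowerSplitOneBit.lean` (seat bsd-2adic-mult GEN 12: `MultTowerCert.towerGapAtTwo_of_layerSelmer_cert_splitTwo_oneBit`,
`MultTowerTorsion.…_splitTwo_oneBit_of_torsion`, `MultTowerTorsion.…_splitTwo_oneBit_of_goodPrime`) with their PRINT hypothesis `hSP1`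
(`Greenberg1999.sec3_natCard_pTorsion_localTowerKerPrimary_le_splitMultiplicative_rat`, Greenberg LNM 1716 pp. 91–92) REMOVED: the binder
is now the tree theorem `MultTowerSP1.sec3_natCard_pTorsion_localTowerKerPrimary_le_splitMultiplicative_rat_holds`
(`…MultTowerSplitOneBitHolds.lean`, this seat; cell memo HOME/mult/NOTE-SP1ONE.md §5). WHAT IS STILL DISPLAYED, NOT PROVED: PRINT
{`h33g`, `hM`, `hA`}; the layer counts `hlow`/`hup`, the torsion data and the arithmetic `harith` (certificate legs).
References: R. Greenberg, LNM 1716 (1999) §3 pp. 85–93.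
-/

set_option autoImplicit false
-- the Theorems namespace of this sub repeats the summit name by design (D-0017 nested layout: Summit.<S>.<Sub>)
set_option linter.dupNamespace false

noncomputable section

open scoped Classical

open NumberField IsDedekindDomain WeierstrassCurve Literature.NumberTheory.EllipticCurves
  Literature.NumberTheory.EllipticCurves.Greenberg1999
  Summit.BirchSwinnertonDyer.Rank1Residual.X5 Summit.BirchSwinnertonDyer.Rank1Residual.X5.O1
  Summit.BirchSwinnertonDyer.Rank1Residual

namespace Summit.BirchSwinnertonDyer.BirchSwinnertonDyer.Theorems.MultTowerCert

variable (W : WeierstrassCurve ℚ) [W.IsElliptic] [W.IsGloballyMinimal]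

/-- **`h2` at a SPLIT multiplicative `2` with ONE bit, UNCONDITIONALLY in `hSP1`: `C₂ = 2`** at every layer `n` for a globally minimal
`W/ℚ` split multiplicative at `2` — the kernel theorem `MultTowerSP1.sec3_natCard_pTorsion_localTowerKerPrimary_le_splitMultiplicative_rat_holds`
fed to `atTwo_le_two_of_split_oneBit`. [cite: GreenbergLNM1716, §3, between Prop. 3.6 and Prop. 3.7 (PDF pp. 91–92)] -/
theorem atTwo_le_two_of_split_oneBit_kernel (hsplit : W.HasSplitMultiplicativeReductionAtPrime 2) (n : ℕ) :
    ∀ κ : ZpExtension ℚ 2, κ.IsCyclotomic → ∀ v : HeightOneSpectrum (𝓞 ℚ), ((2 : ℕ) : 𝓞 ℚ) ∈ v.asIdeal →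
      Finite {x : W.localTowerKerPrimary κ (v.adicCompletion ℚ) n // 2 • x = 0} ∧
        Nat.card {x : W.localTowerKerPrimary κ (v.adicCompletion ℚ) n // 2 • x = 0} ≤ 2 :=
  atTwo_le_two_of_split_oneBit W MultTowerSP1.sec3_natCard_pTorsion_localTowerKerPrimary_le_splitMultiplicative_rat_holds
    hsplit n

/-- **The ONE-BIT GAP certificate at a SPLIT multiplicative `2`, with `hSP1` discharged** (odd torsion order): PRINT {`h33g`, `hM`, `hA`}
+ layer counts at `j ≤ j'` with the arithmetic `2^d · 2 · ∏_{ℓ ∈ P} C_ℓ^{2^{min(j', e_ℓ)}} < 2^{2^{j'} − 2^j + a}` ⟹ `O1.TowerGapAtTwo W`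
(= `towerGapAtTwo_of_layerSelmer_cert_splitTwo_oneBit` with `hSP1 := MultTowerSP1.…_holds`).
[cite: GreenbergLNM1716, §3 Lemmas 3.3–3.5 (PDF pp. 86–90) and pp. 90–93] [cite: SilvermanAEC2009, VII.1 Prop. 1.3, VII.5.1] -/
theorem towerGapAtTwo_of_layerSelmer_cert_splitTwo_oneBit_kernel
    (h33g : lemma33_localTowerKerPrimary_eq_bot_of_good.{0})
    (hM : lemma33_localTowerKerPrimary_cyclic_of_multiplicative.{0})
    (hA : lemma33_natCard_localTowerKerPrimary_le_four_of_additive.{0})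
    (hsplit : W.HasSplitMultiplicativeReductionAtPrime 2)
    (htors : ¬ 2 ∣ W.torsionOrder) {j j' a d : ℕ} (hjj' : j ≤ j')
    (P : Finset ℕ) (hP : ∀ ℓ ∈ P, ℓ.Prime ∧ ℓ ≠ 2)
    (hΔ : ∀ ℓ : ℕ, ℓ.Prime → ℓ ≠ 2 → (ℓ : ℤ) ∣ W.minimalDiscriminantInt → ℓ ∈ P)
    (C e k : ℕ → ℕ) (he : ∀ ℓ ∈ P, ¬ 2 ^ (e ℓ + 4) ∣ ℓ ^ 2 - 1)
    (hC : ∀ (ℓ : ℕ) [Fact ℓ.Prime], ℓ ∈ P →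
      4 ≤ C ℓ ∨ (W.HasMultiplicativeReductionAtPrime ℓ ∧ 2 ≤ C ℓ) ∨
        (W.HasMultiplicativeReductionAtPrime ℓ ∧ (ℓ : ℤ) ^ k ℓ ∣ W.minimalDiscriminantInt ∧
          ¬ (ℓ : ℤ) ^ (k ℓ + 1) ∣ W.minimalDiscriminantInt ∧ ¬ 2 ∣ k ℓ ∧ 1 ≤ C ℓ) ∨
        (¬ (ℓ : ℤ) ∣ W.minimalDiscriminantInt ∧ 1 ≤ C ℓ))
    (hlow : ∀ κ : ZpExtension ℚ 2, κ.IsCyclotomic →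
      2 ^ a ≤ Nat.card {z : W.selmerLayer κ j // 2 • z = 0})
    (hup : ∀ κ : ZpExtension ℚ 2, κ.IsCyclotomic →
      Nat.card {z : W.selmerLayer κ j' // 2 • z = 0} ≤ 2 ^ d)
    (harith : 2 ^ d * 2 * ∏ ℓ ∈ P, C ℓ ^ 2 ^ min j' (e ℓ) < 2 ^ (2 ^ j' - 2 ^ j + a)) :
    TowerGapAtTwo W :=
  towerGapAtTwo_of_layerSelmer_cert_splitTwo_oneBit W h33g hM hA
    MultTowerSP1.sec3_natCard_pTorsion_localTowerKerPrimary_le_splitMultiplicative_rat_holds hsplit htors hjj' P hP hΔ C e k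
    he hC hlow hup harith

end Summit.BirchSwinnertonDyer.BirchSwinnertonDyer.Theorems.MultTowerCert

namespace Summit.BirchSwinnertonDyer.BirchSwinnertonDyer.Theorems.MultTowerTorsion

variable (W : WeierstrassCurve ℚ) [W.IsElliptic] [W.IsGloballyMinimal]

/-- **The ONE-BIT GAP certificate at a SPLIT multiplicative `2`, rational `2`-torsion allowed, with `hSP1` discharged** (any lower layer
`j`): `towerGapAtTwo_of_layerSelmer_cert_splitTwo_oneBit_of_torsion` with `hSP1 := MultTowerSP1.…_holds`; arithmetic
`2^{d+t} · 2 · ∏_{ℓ∈P} C_ℓ^{2^{min(j', e_ℓ)}} < 2^{2^{j'} − 2^j + a}`.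
[cite: GreenbergLNM1716, §3 pp. 85–94 (Lemmas 3.3–3.5; between Prop. 3.6 and 3.7, PDF pp. 91–93)]
[cite: SilvermanAEC2009, VII.1 Prop. 1.3, VII.5.1] -/
theorem towerGapAtTwo_of_layerSelmer_cert_splitTwo_oneBit_of_torsion_kernel
    (h33g : lemma33_localTowerKerPrimary_eq_bot_of_good.{0})
    (hM : lemma33_localTowerKerPrimary_cyclic_of_multiplicative.{0})
    (hA : lemma33_natCard_localTowerKerPrimary_le_four_of_additive.{0})
    (hsplit : W.HasSplitMultiplicativeReductionAtPrime 2)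
    (hB : ∀ κ : ZpExtension ℚ 2, κ.IsCyclotomic →
      Finite (FixedPoints.addSubgroup κ.kerSubgroup (geomPrimaryTorsion W 2)))
    {j j' a d t : ℕ} (hjj' : j ≤ j')
    (htor : ∀ κ : ZpExtension ℚ 2, κ.IsCyclotomic →
      Nat.card {m : geomPrimaryTorsion W 2 | ∀ σ ∈ κ.layerSubgroup j, σ • m = m} ≤ 2 ^ t)
    (P : Finset ℕ) (hP : ∀ ℓ ∈ P, ℓ.Prime ∧ ℓ ≠ 2)
    (hΔ : ∀ ℓ : ℕ, ℓ.Prime → ℓ ≠ 2 → (ℓ : ℤ) ∣ W.minimalDiscriminantInt → ℓ ∈ P)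
    (C e k : ℕ → ℕ) (he : ∀ ℓ ∈ P, ¬ 2 ^ (e ℓ + 4) ∣ ℓ ^ 2 - 1)
    (hC : ∀ (ℓ : ℕ) [Fact ℓ.Prime], ℓ ∈ P →
      4 ≤ C ℓ ∨ (W.HasMultiplicativeReductionAtPrime ℓ ∧ 2 ≤ C ℓ) ∨
        (W.HasMultiplicativeReductionAtPrime ℓ ∧ (ℓ : ℤ) ^ k ℓ ∣ W.minimalDiscriminantInt ∧
          ¬ (ℓ : ℤ) ^ (k ℓ + 1) ∣ W.minimalDiscriminantInt ∧ ¬ 2 ∣ k ℓ ∧ 1 ≤ C ℓ) ∨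
        (¬ (ℓ : ℤ) ∣ W.minimalDiscriminantInt ∧ 1 ≤ C ℓ))
    (hlow : ∀ κ : ZpExtension ℚ 2, κ.IsCyclotomic →
      2 ^ a ≤ Nat.card {z : W.selmerLayer κ j // 2 • z = 0})
    (hup : ∀ κ : ZpExtension ℚ 2, κ.IsCyclotomic →
      Nat.card {z : W.selmerLayer κ j' // 2 • z = 0} ≤ 2 ^ d)
    (harith : 2 ^ (d + t) * 2 * ∏ ℓ ∈ P, C ℓ ^ 2 ^ min j' (e ℓ) < 2 ^ (2 ^ j' - 2 ^ j + a)) :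
    TowerGapAtTwo W :=
  towerGapAtTwo_of_layerSelmer_cert_splitTwo_oneBit_of_torsion W h33g hM hA
    MultTowerSP1.sec3_natCard_pTorsion_localTowerKerPrimary_le_splitMultiplicative_rat_holds hsplit hB hjj' htor P hP hΔ
    C e k he hC hlow hup harith

/-- **The ONE-BIT GAP certificate at a SPLIT multiplicative `2`, lower layer `ℚ`, with `hSP1` discharged, every remaining datum PRINT or
decidable**: `towerGapAtTwo_of_layerSelmer_cert_splitTwo_oneBit_of_goodPrime` with `hSP1 := MultTowerSP1.…_holds` (`hBtors` may be fed by
name with the tree theorem `Greenberg1999.finite_torsion_cyclotomicZpExtension_holds`); arithmetic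
`2^{d+t} · 2 · ∏_{ℓ∈P} C_ℓ^{2^{min(j', e_ℓ)}} < 2^{2^{j'} − 1 + a}`.
[cite: GreenbergLNM1716, §1 p. 62, §3 pp. 85–94, §4 Lemma 4.3] [cite: SilvermanAEC2009, VII.3 Prop. 3.1(b), VII.5.1]
[cite: Ribet1981KatzLangAppendix, Theorem (p. 315)] -/
theorem towerGapAtTwo_of_layerSelmer_cert_splitTwo_oneBit_of_goodPrime_kernel
    (h33g : lemma33_localTowerKerPrimary_eq_bot_of_good.{0})
    (hM : lemma33_localTowerKerPrimary_cyclic_of_multiplicative.{0})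
    (hA : lemma33_natCard_localTowerKerPrimary_le_four_of_additive.{0})
    (hsplit : W.HasSplitMultiplicativeReductionAtPrime 2)
    (hBtors : finite_torsion_cyclotomicZpExtension)
    (ℓ₀ : ℕ) [Fact ℓ₀.Prime] (h3 : 3 ≤ ℓ₀) (hgood : W.HasGoodReductionAtPrime ℓ₀) {t n : ℕ}
    (hn : W.reductionPointCount ℓ₀ = n) (hndvd : ¬ 2 ^ (t + 1) ∣ n) {j' a d : ℕ}
    (P : Finset ℕ) (hP : ∀ ℓ ∈ P, ℓ.Prime ∧ ℓ ≠ 2)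
    (hΔ : ∀ ℓ : ℕ, ℓ.Prime → ℓ ≠ 2 → (ℓ : ℤ) ∣ W.minimalDiscriminantInt → ℓ ∈ P)
    (C e k : ℕ → ℕ) (he : ∀ ℓ ∈ P, ¬ 2 ^ (e ℓ + 4) ∣ ℓ ^ 2 - 1)
    (hC : ∀ (ℓ : ℕ) [Fact ℓ.Prime], ℓ ∈ P →
      4 ≤ C ℓ ∨ (W.HasMultiplicativeReductionAtPrime ℓ ∧ 2 ≤ C ℓ) ∨
        (W.HasMultiplicativeReductionAtPrime ℓ ∧ (ℓ : ℤ) ^ k ℓ ∣ W.minimalDiscriminantInt ∧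
          ¬ (ℓ : ℤ) ^ (k ℓ + 1) ∣ W.minimalDiscriminantInt ∧ ¬ 2 ∣ k ℓ ∧ 1 ≤ C ℓ) ∨
        (¬ (ℓ : ℤ) ∣ W.minimalDiscriminantInt ∧ 1 ≤ C ℓ))
    (hlow : ∀ κ : ZpExtension ℚ 2, κ.IsCyclotomic →
      2 ^ a ≤ Nat.card {z : W.selmerLayer κ 0 // 2 • z = 0})
    (hup : ∀ κ : ZpExtension ℚ 2, κ.IsCyclotomic →
      Nat.card {z : W.selmerLayer κ j' // 2 • z = 0} ≤ 2 ^ d)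
    (harith : 2 ^ (d + t) * 2 * ∏ ℓ ∈ P, C ℓ ^ 2 ^ min j' (e ℓ) < 2 ^ (2 ^ j' - 1 + a)) :
    TowerGapAtTwo W :=
  towerGapAtTwo_of_layerSelmer_cert_splitTwo_oneBit_of_goodPrime W h33g hM hA
    MultTowerSP1.sec3_natCard_pTorsion_localTowerKerPrimary_le_splitMultiplicative_rat_holds hsplit hBtors ℓ₀ h3 hgood hn
    hndvd P hP hΔ C e k he hC hlow hup harith

end Summit.BirchSwinnertonDyer.BirchSwinnertonDyer.Theorems.MultTowerTorsion

end
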